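import Mathlib
import HarnessLib
import HarnessLib.Audit
import Summits.ABC.Statement
import Literature.NumberTheory.DiophantineGeometry.FunctionFieldDivisors

/-!
Route: GvfSupportTransfer

DORMANT since 2026-09-03T05:15:01Z (reconciler: no traction for 5 d (last activity item-evidence-added at 2026-08-29T04:42:35Z); parked, not closed — `ledger route dormant route-ABC-GvfSupportTransfer --off` to reactivate) — unstaffed, not closed; items shared with open routes are served there. `ledger route dormant <id> --off` reactivates.

Route for idea card ABC/ABC/gvf-support-transfer ("radical as a truncation functional in globally
valued fields"), in corrected form. In the GVF language of Ben Yaacov–Hrushovski (heights h(t₀:…:tₙ)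
of projective tuples of field terms) put, for a support element z and a COVERING variable y: Z_y(z)
:= h(1:z⁻¹) + h(1:y⁻¹) − h(1:z⁻¹:y⁻¹) = ∫ min(v(z)⁺, v(y)⁺) dμ and U_K(z,y) := h(1:z⁻¹:y^(−K)) −
h(1:y^(−K)) = ∫ (v(z)⁺ − K·v(y)⁺)⁺ dμ. The universal GVF sentences A_K (K ≥ 1): for all x, y: h(1:x)
≤ Σ_{z ∈ {x, 1−x, 1/x}} [Z_y(z) + U_K(z,y)] hold identically in every rational function field k(t)
of characteristic 0 (per support place Z+U ≥ 1, so the bracket dominates #x⁻¹{0,1,∞} ≥ deg x + 1: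
Mason–Stothers), up to 2g−2 in k(C), FAIL over ℚ̄ for K ≥ 4 (K-th roots), and over ℚ the asymptotic
truth of all A_K is EQUIVALENT to abc: the optimal covering y_K = ∏p^⌈v_p(abc)/K⌉/q^j makes U_K ≡ 0
and the bracket = log ∏p^⌈v_p(abc)/K⌉ + (1/K)·log(c/min(a,b)) + o(log c), i.e. A_K(ℚ) is the level-K
root-stack abc of Ellenberg–Satriano–Zureick-Brown / Nasserden–Xiao with an archimedean discount.
THESIS X ("it suffices to show X"): X := RationalTransferAK — every A_K holds asymptotically on ℚ²:
∀K ≥ 1 ∀δ > 0 ∃H₀ ∀x,y ∈ ℚ (x ∉ {0,1}, y ≠ 0, h(1:x) ≥ H₀): h(1:x) − Σ_z [Z_y(z) + U_K(z,y)] ≤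
δ·(h(1:x) + h(1:y)). The LINE OF ATTACK on X is transfer, in two strengths. The minimal sufficient
hypothesis is LINEAR LAW TRANSFER (crux LinearLawTransfer, LLT): every ℝ-linear combination of
finitely many two-variable height functionals h(T_j(x,y)) (T_j a tuple of integer polynomials) that
is ≤ C·max(0, 2g−2) identically on all complex function fields of one variable is ≤ δ·h(1:x:y)
asymptotically on ℚ² — the asymptotic universal LINEAR height theory of ℚ contains that of the
genus-negligible class; with Mason–Stothers-with-genus in A_K form (support FunctionFieldAKGenus:
the law φ_K ≤ max(0,2g−2), Mason 1984) it yields X through the glue LawTransferGlue, and the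
deciding theorem is LLT → FunctionFieldAKGenus → LawTransferGlue → Assembly → ABC. The stronger,
existential form is the genus-negligible DENSITY conjecture GND (crux GenusNegligibleDensity:
rescaled rational pairs are shadowed, on every finite family of height functionals, by pairs in
complex function fields with σ(2g−2) negligible — the genus-controlled, RATIONAL-point converse of
BYH Cor. 2.3), the form a positivity/density proof would deliver; GND → LLT is the support
DensityImpliesLawTransfer and TransferGlue = LawTransferGlue ∘ DensityImpliesLawTransfer.
Calibration: ToricLawTransfer (support, provable now) — LLT holds unconditionally for monomial
functionals in X, Y (balanced configurations are realised by Laurent-monomial rational curves), so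
the whole content of the transfer sits in the unit equation x + (1−x) = 1, i.e. in functionals
involving 1 − X. Assembly is X → ABC.
Lean: `let h2 : ℚ → ℝ := fun u => Height.logHeight ![(1 : ℚ), u]; let h3 : ℚ → ℚ → ℝ := fun u w =>
Height.logHeight ![(1 : ℚ), u, w]; let Z : ℚ → ℚ → ℝ := fun y z => h2 z⁻¹ + h2 y⁻¹ - h3 z⁻¹ y⁻¹; let
U : ℕ → ℚ → ℚ → ℝ := fun K y z => h3 z⁻¹ (y⁻¹ ^ K) - h2 (y⁻¹ ^ K); ∀ K : ℕ, 1 ≤ K → ∀ δ : ℝ, 0 < δ →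
∃ H₀ : ℝ, ∀ x y : ℚ, x ≠ 0 → x ≠ 1 → y ≠ 0 → H₀ ≤ h2 x → h2 x - ((Z y x + U K y x) + (Z y (1 - x) +
U K y (1 - x)) + (Z y x⁻¹ + U K y x⁻¹)) ≤ δ * (h2 x + h2 y)`
## Assembly
Assembly := RationalTransferAK → ABC. Given ε take K = ⌈40/ε⌉ and δ = ε/40; for an abc triple put x
= a/c and y = Y/q^j with Y = ∏_{p|abc} p^⌈v_p(abc)/K⌉, q the least prime not dividing abc (Bertrand
chain: log q ≪ √log c), j = ⌈(log Y + log(c/min(a,b))/K)/log q⌉; then every U_K term vanishes, the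
finite Z terms sum to log Y ≤ log rad(abc) + (3/K) log c, the archimedean ones to ≤ 2(log c/K + log
q), and h(1:y) ≤ 5 log c, so X gives (1 − 5/K − 6δ − o(1)) log c ≤ log rad(abc), i.e. c <
C_ε·rad(abc)^(1+ε).

Rationale: WHY THIS LINE. Model-theoretic transfer (catalogue moves: model-theoretic transfer + pass to the
limit object): Ben Yaacov–Hrushovski's globally valued fields make "ℤ behaves like k[t]" a statement
about universal theories of rescaled ultraproducts, and the algebraically closed case is completely
understood — k(t)^alg[1] is existentially closed (BenYaacovHrushovski2022GVF Thm 2.1), the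
asymptotic universal theory of ℚ̄[r] is exactly the GVF axioms (Rem 2.2), ℚ̄[1] is e.c.
(Szachniewicz2023QbarGVF), foundations and e.c. formalism in BYDHS2024GVFFoundations §§11–12, survey
ChambertLoir2025GVF — while the support of a function, hence abc, is declared inexpressible (BYH
p.5). The card's observation, CORRECTED here (its covering y = rad(abc) with penalty "P_K = O(1/K)"
is wrong on prime-power-heavy triples, and support coverage is not closed in the type topology), is
that support is expressible up to 1/K in the plain GVF language once a covering variable is
universally quantified: Mason–Stothers becomes the universal sentences A_K, true in k(t), and abc
over ℚ is exactly their asymptotic truth X, each A_K(ℚ) being the level-K root-stack abc of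
EllenbergSatrianoZureickBrown2023 §4.7 / NasserdenXiao2024 Thm 1.4 with an archimedean discount —
one dictionary entry joining GVF logic, Vojta1987's dictionary and stacky heights. Since A_K fails
over ℚ̄ (K-th roots; item FailsForQuarticPoints) the content sits precisely in RATIONALITY +
GENUS-NEGLIGIBILITY, and the line of attack is the density conjecture GND: rescaled rational pairs
are limits of genus-negligible complex function-field pairs (the genus-controlled converse of BYH
Cor 2.3 for RATIONAL points), to be proved by the positivity methods (BDPP duality, movable curves)
that proved existential closedness or by axiomatising the universal theory of the genus-negligible
class. Imported: continuous-logic GVF machinery (Łoś 11.10, compactness 11.14, qf-type density =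
e.c. Lemma 12.2 of BYDHS), Mason–Stothers / Riemann–Hurwitz strictly inside k(t), k(C) (Mathlib
Polynomial.abc; Literature FunctionFieldResidues / FunctionFieldHurwitzTame), Weil heights (Mathlib
Height.*, Rat.logHeight_eq_max_abs_of_gcd_eq_one).
RANKED CRUXES. #2 GenusNegligibleDensity — for every finite family of integer polynomial tuples T_j
and ε > 0, all rational pairs (x,y) off the curves T_ji = 0 with L = h(1:x:y) ≥ H₀ are shadowed by
(F/ℂ with trdeg 1, finitely generated, g bounding deg D + 1 − ℓ(D) for all divisors D, ξ, η, σ) with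
σ(2g−2) ≤ εL and |h(T_j(x,y)) − σ·h_F(T_j(ξ,η))| ≤ εL for all j (why it might fail: already ≥ abc
through its 13-functional instance; transfers EVERY universal height law of genus-negligible ℂ(C),
also the non-convex/disjunctive ones, so ONE two-variable ℤ/k(C) discrepancy for rational points
kills it; false over ℚ̄; sources BenYaacovHrushovski2022GVF, BYDHS2024GVFFoundations,
arXiv:2601.04972, Vojta1987). #3 LinearLawTransfer — for every T, coefficients c_j ∈ ℝ and C ∈ ℝ: if
Σ_j c_j·h_F(T_j(ξ,η)) ≤ C·max(0, 2g−2) for all F/ℂ (trdeg 1, f.g., g as above) and all ξ, η off the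
curves, then ∀δ ∃H₀: Σ_j c_j·h(T_j(x,y)) ≤ δ·h(1:x:y) for all rational (x,y) off the curves with
h(1:x:y) ≥ H₀ (why it might fail: ≥ abc via the A_K law; it transfers every linear-in-genus law of
complex curves — n-term Brownawell–Masser shapes, Corvaja–Zannier gcd bounds — to ℚ², one such law
failing by a positive fraction of height along a rational family refutes it; false over ℚ̄ of degree
≥ 4; sources Vojta1987, BenYaacovHrushovski2022GVF Rem 2.2, BYDHS2024GVFFoundations Lemma 12.2,
BombieriGubler2006, doi:10.1090/S1056-3911-07-00489-4). LLT is implied by GND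
(DensityImpliesLawTransfer, bookkeeping: σ·Σc_j h_F ≤ C·max(0, σ(2g−2)) ≤ CεL) and is what the
deciding theorem uses; GND is kept as the rank-2 crux because it is the statement refuters can
attack most cheaply and the one the density/positivity mechanism would prove. Support (rank 3)
FunctionFieldAKGenus — Mason–Stothers with genus in covering form: in every F/ℂ, h(1:x) −
Σ_z[Z_y(z)+U_K(z,y)] ≤ max(0, 2g−2) (known: Mason 1984 Ch. I §3 Lemma 2, vendored as Literature fact
Mason1984_lemma2, ∘ local counting; fails only as stated). Target #0 RationalTransferAK (= X,
abc-equivalent by Assembly + ABCImpliesTransfer); Assembly #1.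
KILL CRITERIA. (o) A refutation of LinearLawTransfer — an explicit T, c, C with the function-field
law proved and a rational family violating Σ c_j h(T_j) ≤ δL by a fixed fraction of height — closes
the route outright (close --reason refuted:LinearLawTransfer): it kills GND as well and shows ℤ ≠
k[t] already at the level of linear height laws in two variables. (i) A refutation of
GenusNegligibleDensity — an explicit finite family T and a sequence of rational pairs whose rescaled
profile stays ε-far from every genus-negligible function-field profile (witnessed by a universal
height inequality valid in all k(C) up to 2g−2 and violated asymptotically over ℚ: candidates gcd
profiles of (2ⁿ+1, 3ⁿ+1), simultaneous-approximation types, S-unit points on blow-ups, consecutive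
powerful numbers) — demotes the line to LLT if the witness is a non-realisability with all linear
laws intact (route edit --drop GenusNegligibleDensity; the density mechanism is dead, transfer would
need disjunctive laws), and closes the route as in (o) if the witness is a violated linear law; X ⟺
ABC then survives only as a reformulation (close exhausted with census). (ii) A refutation of
RationalTransferAK for one K disproves ABC (ABCImpliesTransfer) — terminal for the summit, maximal
value. (iii) FunctionFieldAKGenus failing as stated ⇒ restate, no pivot. (iv) A proof that GND is
EQUIVALENT to abc (no surplus content) makes the route dormant: packaging, not mechanism.
NOT DECOMPOSED YET. GND and LLT are single nodes. The duality statement separating them — the closed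
cone of rescaled T-profiles of genus-negligible complex pairs is CONVEX, equivalently GND ⇐ LLT +
realisability of every profile obeying all linear laws (an amalgamation property of the
genus-negligible class) — is deliberately not itemised: it is pure geometry, but its typing (profile
cones, finite law families) should follow a refuter pass on GND. Foreseen glued split once refuters
have probed it: GND ⇐ GNDToric (types supported on monomial valuations in x, 1−x, y:
Laurent-monomial rational curves realise every balanced configuration; plus the asymptotic
three-point Hurwitz problem "closure of rescaled genus-0 ramification profiles = Mason–Stothers body
{Σ_P ∫ κ_P dρ_P ≥ 1, κ(n/m) = 1/m}") → GNDCentres (valuations centred at (0,0), (1,0), (∞,0):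
polynomial abc triples with prescribed multiplicity profiles) → GND. The arithmetic-positivity
attack (arithmetic BDPP / volume duality producing genus-negligible classes: Ikoma, Chen–Moriwaki,
Yuan–Zhang) is not itemised. Transfers BEYOND abc (Corvaja–Zannier function-field gcd inequality →
Levin-type gcd statements over ℚ; n-term sums — the naive 4-term covering sentence is FALSE in k(t)
on the degenerate locus x = −y once K > 12, so Brownawell–Masser needs a quantitative non-degeneracy
term) are the first tenure-mode additions if GND survives refutation. No third layer; lemmas ride
with --supports.
CHEAPEST FALSIFIER. No curve search is needed to attack GND: every universal height law of
genus-negligible function fields is a linear test on arithmetic profiles. Kit job (minutes): for the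
candidate families above compute the rescaled values of the 13 A_K tuples (K = 4..8) and of the gcd
tuples (1:(x−1)⁻¹:(y−1)⁻¹), (1:(x−1)⁻¹:(y−1)^(−K)) and test φ_K ≤ o(1) and the
Corvaja–Zannier-shaped gcd bound; one inequality violated along an infinite family refutes
GenusNegligibleDensity (and, if it is an A_K, refutes ABC). Cheapest positive checks: prove
FunctionFieldAK from Polynomial.abc and ToricLawTransfer (both provable now).
TWO-LAYER PLAN. Layer 1: LinearLawTransfer (deciding spine), GenusNegligibleDensity (stronger form).
Glue (support, provable bookkeeping): LawTransferGlue: LinearLawTransfer → FunctionFieldAKGenus →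
RationalTransferAK; DensityImpliesLawTransfer: GenusNegligibleDensity → LinearLawTransfer;
TransferGlue (GenusNegligibleDensity → FunctionFieldAKGenus → RationalTransferAK) is their
composition. LawTransferGlue applies LLT to the A_K law with C = 1, c_j ∈ {±1}, using the 13
monomial tuples (1,X), (1,Y), (XY,Y,X), (XY^K,Y^K,X), ((1−X)Y,Y,1−X), ((1−X)Y^K,Y^K,1−X), (Y,XY,1),
(Y^K,XY^K,1), (X,1), (1−X,1), (Y,1), (Y^K,1) — non-vanishing off x ∈ {0,1}, y = 0; projective
invariance of logHeight on ℚ, product formula on F. Layer 2 (after a crux closes): the split of GND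
above; nothing deeper.
SUPPORT. FunctionFieldAK (g = 0 over any char-0 field, RatFunc heights by num/denom degrees; Mathlib
Polynomial.abc — provable now, calibrates the dictionary); ToricLawTransfer (LLT restricted to
monomial tuples X^a·Y^b — provable now: heights of monomial tuples are sums over places of maxima of
linear forms in (v(x), v(y)), a balanced configuration by the product formula on both sides; every
balanced INTEGER configuration is realised in ℂ(t) (g = 0) by ξ = ∏(t−a_k)^{m_k}, η =
∏(t−a_k)^{n_k}, so a law valid on function fields is ≤ 0 on integer balanced configurations, hence
by homogeneity, rational approximation of the weights log p and continuity on the real balanced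
configuration of a rational point: Σ c_j h(T_j(x,y)) ≤ 0 ≤ δL; shows all transfer content lives in
functionals with 1 − X); FunctionFieldAKGenus (rank 3, known); LawTransferGlue;
DensityImpliesLawTransfer; TransferGlue; ABCImpliesTransfer (ABC → X: bracket ≥ log rad(abc); shows
X ⟺ ABC, an honest transfer formulation); FailsForQuarticPoints (A_4 fails on (N,
(N(1−N)/(1+N³))^(1/4)): rationality is essential; consistent with UniformABCDiscriminantSharp).
DEGENERATE CASES CHECKED. Constants/units: h(1:x) = 0, bracket ≥ 0. K ≤ 3: A_K(ℚ) is trivially true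
(bracket ≥ (1/K)(log max(a,b) + 2 log c) ≥ log c − O(1)), content starts at K = 4. Char p: A_K false
(x = t^p/(t+1)^p, y = t(t+1)/(t−2)³, K ≥ p) — CharZero / ℂ in every function-field signature.
One-variable types are trivial (λ·h(P₀(x):…:Pₙ(x)) → degree of the map, Weil height machine), so two
variables are the minimum and the covering variable is indispensable. E(ℚ) of positive rank forces
genus-1 approximants ([n] on E) — hence genus-NEGLIGIBLE, not genus 0, and points ON test curves
excluded. Consistency of GND checked by hand on (2ⁿ, 3ⁿ) (curves t^A, (t−1)^B), BCZ gcd vs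
Ailon–Rudnick, Pell sequences (conic parametrisation), Roth concentration at the archimedean place
(matched by ξ² − g² = 2), near-Fermat-quartic points (forbidden on both sides).
NUMBERS. Assembly losses 5/K + 6δ (K = ⌈40/ε⌉, δ = ε/40); least prime q ∤ abc: log q ≤ 2√(3 log c) +
1 by a Bertrand chain; FailsForQuarticPoints: bracket = (3/4)h(1:x) + O(1), φ_4 = h/4, δ = 1/8; ℚ̄
failure φ_K = (1 − 3/K)h on points of degree K, the curve y^K = x(1−x)/(1+x³) has genus 2K−2 over
degree K (not genus-negligible).
SOURCES. BenYaacovHrushovski2022GVF (read pp.4–6: §1.3, Thm 2.1, Rem 2.2, Cor 2.3–2.5, p.5),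
BYDHS2024GVFFoundations (read pp.44–49: 11.10–11.15, §12), Szachniewicz2023QbarGVF,
ChambertLoir2025GVF, arXiv:2601.04972 §2.5, Vojta1987 (dictionary; Ch.5 §5), Stothers1981 + Mathlib
Polynomial.abc (Literature mason_stothers), Stichtenoth2009 (Cor 3.5.5, Thm 3.4.13),
EllenbergSatrianoZureickBrown2023 §4.7 Def 34 / Conj 35, NasserdenXiao2024 Thm 1.4,
BombieriGubler2006 Conj 12.2.2 and §12.4, card rounded-radical-thue-ladder (k_r ladder) and its
audit.
DEFINITION REQUESTS. None: all eleven items elaborate over Mathlib (Height.logHeight on ℚ and number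
fields, MvPolynomial.aeval/X, RatFunc.num/denom, EuclideanDomain.gcd, Algebra.trdeg,
IntermediateField.FG) and Literature FunctionFieldDivisors ONLY
(AlgFunctionField.PlaceOver/.ord/.degree, Divisor.degree, ell — its nine named facts are all
discharged in-tree: ord_mul, min_ord_le_ord_add, ord_algebraMap, ord_uniformizer,
valuation_le_pow_iff, mem_riemannRochSpace_iff_ord, ell_eq_zero_of_deg_lt_zero,
ell_congr_of_isLinearlyEquivalent, degree_principalDivisor); `IsAlgFunctionField ℂ F` is inlined as
`Algebra.trdeg ℂ F = 1 ∧ (⊤ : IntermediateField ℂ F).FG` and `genus` as any g : ℕ with ∀ D, deg D +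
1 − ℓ(D) ≤ g (equivalent by the proved facts degree_add_one_sub_ell_le_genus / bddAbove_genusSet),
so the route imports nothing from FunctionFieldGenus / EllipticCurves.FunctionFieldPlaces
(route-repair 2026-08-15: import cone freed of undischarged facts); Sketch checked rc 0 on the farm.

Novelty: Searches run (2026-08-15): lit search "globally valued fields abc conjecture Vojta" (local searchd
reset; zbMATH 19 rows — only the GVF corpus 2212.07269 / 2409.04570 / 2506.20120 relevant); lit
search --hybrid "globally valued field universal theory rational points transfer Mason" (noise); lit
galaxy search "globally valued field" --star all (1 hit: Chen–Moriwaki, Arakelov geometry over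
adelic curves — no abc); OpenAlex / arXiv / S2 rate-limited (429). READ: BenYaacovHrushovski2022GVF
= arXiv:2212.07269 pp.4–6 (§1.3 universal axioms; Thm 2.1; Rem 2.2 "the asymptotic universal theory
of ℚalg[r] is precisely GVF"; p.5 "the GVF language … does not permit discussing the support of a
function, the most interesting parts of the dictionary are not currently accessible"; Cor 2.3/2.5:
curves with NO genus control); BYDHS2024GVFFoundations = arXiv:2409.04570 pp.44–49 (Łoś 11.10;
Example 11.12: M[η,u] is the MEROMORPHIC-function GVF, so the p.45 'universal theories coincide' is
Nevanlinna ↔ C(t)^alg, not a ℚ̄ statement; Lemma 12.2; Cor 12.8); ChambertLoir2025GVF =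
arXiv:2506.20120 (grep abc|Mason|radical: nothing); card rounded-radical-thue-ladder and its novelty
audit (EllenbergSatrianoZureickBrown2023 = arXiv:2106.11340 §4.7 Def 34; NasserdenXiao2024 =
arXiv:2108.04411 Thm 1.4: root-stack height k_K = ∏p^⌈v_p/K⌉ and stacky-abc rungs ⟺ abc). Nearest
prior art: BYH/BYDHS/Szachniewicz (e.c. and universal-theory transfer for ALGEBRAICALLY CLOSED GVFs,
support declared inexpressible) and  [refs: 2212.07269, 2409.04570, 2506.20120, 2106.11340, 2108.04411, EllenbergSatrianoZureickBrown2023, NasserdenXiao2024]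

Barriers (technique_class: gvf-transfer model-theory mason-stothers stacky-height): - technique_class: gvf-transfer model-theory mason-stothers stacky-height
- Literature.Barriers.ABC.IntegersHaveNoDerivation: nothing is differentiated over ℤ and no additive
Leibniz map on ℤ is posited; Mason–Stothers / Riemann–Hurwitz are applied only inside k(t), k(C)
(items FunctionFieldAK, FunctionFieldAKGenus); what crosses to ℤ is a universal sentence via density
of types (GND) — the approximating curve is the 'substitute for the derivative' (Vojta1987 Ch.6 §7
asks for one).
- Literature.Barriers.ABC.MasonStothersFailsInCharP: built in — A_K is FALSE in 𝔽_p(t) (x =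
t^p/(t+1)^p, y = t(t+1)/(t−2)³, K ≥ p gives φ_K = p − 3 > 0); the function-field items carry
CharZero resp. ℂ, and GND approximates by COMPLEX function fields only, so no Frobenius family is
ever transferred.
- Literature.Barriers.ABC.EpsilonCannotBeDropped: respected — X is asymptotic (slack δ·height beyond
H₀) and the Assembly yields c < C_ε·rad^(1+ε) with ε ≍ 5/K + 6δ, never ε = 0; the Stewart–Tijdeman /
Bright excess exp(O(√log c/loglog c)) and B–G §12.4 polylog losses are o(log c) and vanish under
rescaling, which is exactly why only degree-1-homogeneous (ε-carrying) inequalities transfer.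
- Literature.Barriers.ABC.SzpiroEpsilonCannotBeDropped: same remark; no Szpiro-type ε = 0 claim.
- Literature.Barriers.ABC.UniformABCDiscriminantSharp: evaded by restriction to ℚ-RATIONAL points;
FailsForQuarticPoints PROVES the sentences false over points of degree 4 without a discriminant
term, so no bounded-degree

History (route lifecycle, newest last):
- 2026-08-15T16:45:38Z · rev 4: restated GenusNegligibleDensity (stmt-ABC-3216), FunctionFieldAKGenus (stmt-ABC-3217) — route-repair (rbadge g2) of route-ABC-GvfSupportTransfer: crux floor 1→2 and import cone freed. (1) imports: FunctionFieldGenus → FunctionFieldDivisors (its 9 n (planner-rbadge-ABC-GvfSupportTransfer-1388b889-g2-0)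
- 2026-08-22T19:45:45Z · DORMANT — reconciler: no traction for 5.6 d (last activity item-evidence-added at 2026-08-17T04:30:18Z); parked, not closed — `ledger route dormant route-ABC-GvfSupportTr (operator:999:153391)
- 2026-08-27T23:48:44Z · REACTIVATED — reconciler: reactivated — activity workitem-claimed at 2026-08-27T22:18:21Z after parking at 2026-08-22T19:45:45Z (operator:999:2366774)
- 2026-09-03T05:15:01Z · DORMANT — reconciler: no traction for 5 d (last activity item-evidence-added at 2026-08-29T04:42:35Z); parked, not closed — `ledger route dormant route-ABC-GvfSupportTran (operator:999:3898625)

sub-problem: ABC · status: dormant · opened planner-plancard-ABC-ABC-gvf-support-transfer-7c0142f2-0 2026-08-15T11:13:09Z · rev 7 · ledger route-ABC-GvfSupportTransfer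
GENERATED by the gate from the ledger (D-0016/17). Provers cite these decls: `theorem foo : Summit.ABC.ABC.Theses.GvfSupportTransfer.<Decl> := …` in Summits/ABC/ABC/Theorems/<Name>.lean.
-/

namespace Summit.ABC.ABC.Theses.GvfSupportTransfer

open scoped BigOperators Topology Manifold Classical MeasureTheory ProbabilityTheory Matrix InnerProductSpace ComplexConjugate ContinuousMap
open Filter Set Function TopologicalSpace MeasureTheory

attribute [summit_statement] _root_.ABC

open Literature.Abc

/-- item stmt-ABC-3214 · target · rank 0 · open · by planner
why it might fail: X ⟺ ABC (Assembly + ABCImpliesTransfer): X fails iff for some K ≥ 4 an infinite family of abc triples has log c ≥ (1+η)(log ∏p^⌈v_p(abc)/K⌉ + (1/K)·log(c/min(a,b))) — a level-K root-stack abc violation; K ≤ 3 is trivially true, so tests need K ≥ 4.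
sources: BenYaacovHrushovski2022GVF, EllenbergSatrianoZureickBrown2023, NasserdenXiao2024, BombieriGubler2006
[target] RATIONAL TRANSFER OF THE SENTENCES A_K (= thesis X): for every K ≥ 1 and δ > 0 there is H₀
such that all x, y ∈ ℚ with x ∉ {0,1}, y ≠ 0, h(1:x) ≥ H₀ satisfy h(1:x) − Σ_{z∈{x,1−x,1/x}} [Z_y(z)
+ U_K(z,y)] ≤ δ·(h(1:x) + h(1:y)); h = Mathlib `Height.logHeight` of a ℚ-tuple (absolute log Weil
height; h(1:a/c) = log max(|a|,c)), Z_y(z) = h(1:z⁻¹) + h(1:y⁻¹) − h(1:z⁻¹:y⁻¹) = Σ_v min(v(z)⁺,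
v(y)⁺)·w_v (zeros of z covered by y, counted once per unit of y) and U_K(z,y) = h(1:z⁻¹:y^(−K)) −
h(1:y^(−K)) = Σ_v (v(z)⁺ − K·v(y)⁺)⁺·w_v (multiplicity left uncovered at level K); local identity a⁺
+ b⁺ − max(0,a,b) = min(a⁺,b⁺) at every place incl. ∞ (v_∞ = −log|·|). Meaning: the universal GVF
sentence A_K — an identity of Mason–Stothers type in k(t), item FunctionFieldAK — holds in every
rescaled ultraproduct of ℚ. Unpacked on abc triples with the optimal covering y_K = ∏_{p|abc}
p^⌈v_p(abc)/K⌉/q^j: A_K(ℚ) ⟺ log c ≤ (1+ε)[log ∏p^⌈v_p(abc)/K⌉ + (1/K)·log(c/min(a,b))] + C_ε — the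
level-K root-stack abc (EllenbergSatrianoZureickBrown2023 §4.7 Def 34; NasserdenXiao2024 Thm 1.4)
with an archimedean discount; trivially true for K ≤ 3, abc-type from K = 4; X ⟺ ABC by Assembly +
ABCImpliesTransfer, -/
@[route_item "route-ABC-GvfSupportTransfer"]
def RationalTransferAK : Prop :=
  let h2 : ℚ → ℝ := fun u => Height.logHeight ![(1 : ℚ), u]; let h3 : ℚ → ℚ → ℝ := fun u w => Height.logHeight ![(1 : ℚ), u, w]; let Z : ℚ → ℚ → ℝ := fun y z => h2 z⁻¹ + h2 y⁻¹ - h3 z⁻¹ y⁻¹; let U : ℕ → ℚ → ℚ → ℝ := fun K y z => h3 z⁻¹ (y⁻¹ ^ K) - h2 (y⁻¹ ^ K); ∀ K : ℕ, 1 ≤ K → ∀ δ : ℝ, 0 < δ → ∃ H₀ : ℝ, ∀ x y : ℚ, x ≠ 0 → x ≠ 1 → y ≠ 0 → H₀ ≤ h2 x → h2 x - ((Z y x + U K y x) + (Z y (1 - x) + U K y (1 - x)) + (Z y x⁻¹ + U K y x⁻¹)) ≤ δ * (h2 x + h2 y)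

-- earlier GenusNegligibleDensity (stmt-ABC-3216, replaced 2026-08-15T16:45:38Z -> stmt-ABC-11082): retired by None — ∀ (m n : ℕ) (T : Fin m → Fin (n + 1) → MvPolynomial (Fin 2) ℤ) (ε : ℝ), 0 < ε → ∃ H₀ : ℝ, ∀ x y : ℚ, (∀ j i, MvPolynomial.aeval ![x, y] (T j i) ≠ 0) → H₀ ≤ Height.logHeight ![(1 : ℚ), x, y] → ∃ (F : Type) (_ : Field F) (_ : Algebra ℂ F) (_ : Literature.NumberTheory.DiophantineGeometry
/-- item stmt-ABC-11082 · crux · rank 2 · open · by planner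
why it might fail: ≥ abc via its 13-tuple instance; transfers EVERY universal height law of genus-negligible ℂ(C) (n-term, gcd, disjunctive shapes) to ℚ²: one law failing on an infinite rational family kills it. False for ℚ̄-points of degree ≥ 4; BYH Thm 2.1/Cor 2.3 give curves with no genus control.
sources: BenYaacovHrushovski2022GVF, BYDHS2024GVFFoundations, Szachniewicz2023QbarGVF, ChambertLoir2025GVF, Vojta1987, arXiv:2601.04972
[crux] GENUS-NEGLIGIBLE DENSITY (GND — the card's transfer conjecture, for RATIONAL points, two
variables; supersedes stmt-ABC-3216, restated 1:1 on 2026-08-15 over Literature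
FunctionFieldDivisors only, meaning unchanged — grounding g13-15 and refuter reviews
6ccfe8e7/bb07b532 on the old item apply verbatim): for every finite family T of (n+1)-tuples of
integer polynomials in X, Y and every ε > 0 there is H₀ such that every (x,y) ∈ ℚ² off the curves
{T_ji = 0} with L := h(1:x:y) ≥ H₀ admits a field F ⊇ ℂ with `Algebra.trdeg ℂ F = 1` and `(⊤ :
IntermediateField ℂ F).FG` (= an algebraic function field of one variable over ℂ, the two fields of
`IsAlgFunctionField`), a genus bound g : ℕ with deg D + 1 − ℓ(D) ≤ g for every divisor D (i.e. g ≥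
genus; g = `AlgFunctionField.genus ℂ F` is admissible by the proved fact
degree_add_one_sub_ell_le_genus, so the item is equivalent to its predecessor), a pair (ξ,η) ∈ F²
off the same curves and a scale σ > 0 with σ(2g−2) ≤ εL and |h(T_j(x,y)) − σ·h_F(T_j(ξ,η))| ≤ εL for
all j; h = Mathlib log Weil height of the ℚ-tuple, h_F(f₀:…:fₙ) = Σ_v deg(v)·max_i(−ord_v f_i) over
`AlgFunctionField.PlaceOver ℂ F` = the k(C)[1]-height (finite support once all -/
@[route_item "route-ABC-GvfSupportTransfer"]
def GenusNegligibleDensity : Prop :=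
  ∀ (m n : ℕ) (T : Fin m → Fin (n + 1) → MvPolynomial (Fin 2) ℤ) (ε : ℝ), 0 < ε → ∃ H₀ : ℝ, ∀ x y : ℚ, (∀ j i, MvPolynomial.aeval ![x, y] (T j i) ≠ 0) → H₀ ≤ Height.logHeight ![(1 : ℚ), x, y] → ∃ (F : Type) (_ : Field F) (_ : Algebra ℂ F) (g : ℕ) (ξ η : F) (σ : ℝ), Algebra.trdeg ℂ F = 1 ∧ (⊤ : IntermediateField ℂ F).FG ∧ (∀ D : Literature.NumberTheory.DiophantineGeometry.AlgFunctionField.Divisor ℂ F, D.degree + 1 - (Literature.NumberTheory.DiophantineGeometry.AlgFunctionField.ell D : ℤ) ≤ g) ∧ 0 < σ ∧ σ * (2 * (g : ℝ) - 2) ≤ ε * Height.logHeight ![(1 : ℚ), x, y] ∧ (∀ j i, MvPolynomial.aeval ![ξ, η] (T j i) ≠ 0) ∧ ∀ j, |Height.logHeight (fun i => MvPolynomial.aeval ![x, y] (T j i)) - σ * ∑ᶠ v : Literature.NumberTheory.DiophantineGeometry.AlgFunctionField.PlaceOver ℂ F, ((v.degree : ℝ) * ⨆ i, (-(v.ord (MvPolynomial.aeval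 ![ξ, η] (T j i))) : ℝ))| ≤ ε * Height.logHeight ![(1 : ℚ), x, y]

/-- item stmt-ABC-11084 · crux · rank 3 · open · by planner
why it might fail: ≥ abc via the A_K law (LawTransferGlue); transfers every linear-in-genus height law of complex curves (Brownawell–Masser n-term, Corvaja–Zannier gcd) to ℚ²: one law violated by a positive height fraction along an infinite rational family refutes it; false over ℚ̄ in degree ≥ 4.
sources: Vojta1987, BenYaacovHrushovski2022GVF, BYDHS2024GVFFoundations, BombieriGubler2006, doi:10.1090/S1056-3911-07-00489-4, Stothers1981
[crux] LINEAR LAW TRANSFER (LLT — the minimal transfer hypothesis of the line; new 2026-08-15): for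
every finite family T of (n+1)-tuples of integer polynomials in X, Y, every coefficient vector c ∈
ℝ^m and constant C ∈ ℝ: IF the linear height law Σ_j c_j·h_F(T_j(ξ,η)) ≤ C·max(0, 2g−2) holds for
every field F ⊇ ℂ with trdeg 1, finitely generated (an algebraic function field of one variable over
ℂ), every genus bound g (deg D + 1 − ℓ(D) ≤ g for all divisors D, i.e. g ≥ genus) and all ξ, η ∈ F
off the curves {T_ji = 0} (h_F(f₀:…:fₙ) = Σ_v deg v·max_i(−ord_v f_i) over
`AlgFunctionField.PlaceOver ℂ F`, the k(C)[1]-height), THEN for every δ > 0 there is H₀ with Σ_j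
c_j·h(T_j(x,y)) ≤ δ·h(1:x:y) for all (x,y) ∈ ℚ² off the same curves with h(1:x:y) ≥ H₀ (h = Mathlib
`Height.logHeight`). Model-theoretic reading: the asymptotic universal GVF theory of ℚ (rational
points, two variables) contains every LINEAR universal sentence 'Σ c_j h(T_j) ≤ 0' valid in the
genus-negligible class of complex curves (BYDHS2024GVFFoundations §§11–12); for ℚ̄ that theory is
only the GVF axioms (BenYaacovHrushovski2022GVF Rem 2.2) and LLT is FALSE for points of degree ≥ 4
(FailsForQuarticPoints: the A_4 law). It -/
@[route_item "route-ABC-GvfSupportTransfer"]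
def LinearLawTransfer : Prop :=
  ∀ (m n : ℕ) (T : Fin m → Fin (n + 1) → MvPolynomial (Fin 2) ℤ) (c : Fin m → ℝ) (C : ℝ), (∀ (F : Type) [Field F] [Algebra ℂ F], Algebra.trdeg ℂ F = 1 → (⊤ : IntermediateField ℂ F).FG → ∀ g : ℕ, (∀ D : Literature.NumberTheory.DiophantineGeometry.AlgFunctionField.Divisor ℂ F, D.degree + 1 - (Literature.NumberTheory.DiophantineGeometry.AlgFunctionField.ell D : ℤ) ≤ g) → ∀ ξ η : F, (∀ j i, MvPolynomial.aeval ![ξ, η] (T j i) ≠ 0) → ∑ j, c j * ∑ᶠ v : Literature.NumberTheory.DiophantineGeometry.AlgFunctionField.PlaceOver ℂ F, ((v.degree : ℝ) * ⨆ i, (-(v.ord (MvPolynomial.aeval ![ξ, η] (T j i))) : ℝ)) ≤ C * max 0 (2 * (g : ℝ) - 2)) → ∀ δ : ℝ, 0 < δ → ∃ H₀ : ℝ, ∀ x y : ℚ, (∀ j i, MvPolynomial.aeval ![x, y] (T j i) ≠ 0) → H₀ ≤ Height.logHeight ![(1 : ℚ), x, y] → ∑ j, c j * Height.logHeight (fun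 i => MvPolynomial.aeval ![x, y] (T j i)) ≤ δ * Height.logHeight ![(1 : ℚ), x, y]

-- earlier FunctionFieldAKGenus (stmt-ABC-3217, replaced 2026-08-15T16:45:38Z -> stmt-ABC-11083): retired by None — ∀ (F : Type) [Field F] [Algebra ℂ F] [Literature.NumberTheory.DiophantineGeometry.IsAlgFunctionField ℂ F], let h2 : F → ℤ := fun u => ∑ᶠ v : Literature.NumberTheory.DiophantineGeometry.AlgFunctionField.PlaceOver ℂ F, (v.degree : ℤ) * max 0 (-(v.ord u)); let h3 : F → F → ℤ := fun u w => 
/-- item stmt-ABC-11083 · support · rank 3 · open · by planner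
why it might fail: True on paper (Riemann–Hurwitz); fails only AS STATED: junk values of ord/degree/ell outside the function-field regime, place-degree weights, a sign slip at poles; genuinely false in char p (Frobenius), which ℂ excludes.
sources: Stothers1981, Stichtenoth2009, doi:10.1017/S0305004100061235, Literature.NumberTheory.DiophantineGeometry.AlgFunctionField.finrank_sub_card_le_genus, Literature.NumberTheory.DiophantineGeometry.AlgFunctionField.sum_neg_ord_eq_finrank, Literature.NumberTheory.DiophantineGeometry.AlgFunctionField.PlaceOver.isRational_of_isAlgClosed
[support] MASON–STOTHERS WITH GENUS IN COVERING FORM (the function-field law the transfer uses;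
supersedes stmt-ABC-3217, restated 1:1 on 2026-08-15 without the class `IsAlgFunctionField`/`genus`:
hypotheses `Algebra.trdeg ℂ F = 1`, `(⊤ : IntermediateField ℂ F).FG` and ANY g : ℕ with deg D + 1 −
ℓ(D) ≤ g for all divisors D — for g = genus this is the old statement and larger g only weaken the
bound, so the item is equivalent given degree_add_one_sub_ell_le_genus; grounding g13-15 (KNOWN IN
PRINT: Mason 1984 Ch. I §3 Lemma 2, vendored Literature fact `Mason1984_lemma2`, ∘ local counting)
and refuter review 6ccfe8e7 (paper proof + sharpness check) apply verbatim): for every such F/ℂ,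
every K ≥ 1 and all x, y ∈ F with x ∉ {0,1}, y ≠ 0: h(1:x) − Σ_{z∈{x,1−x,1/x}} [Z_y(z) + U_K(z,y)] ≤
max(0, 2g − 2), with h(1:u) = Σ_v deg v·max(0, −ord_v u), h(1:u:w) = Σ_v deg v·max(0, −ord_v u,
−ord_v w) over `AlgFunctionField.PlaceOver ℂ F` and Z, U built from them exactly as in the target.
Paper proof: each place of x⁻¹{0,1,∞} contributes ≥ 1 to the bracket (if ord_v y ≥ 1 the Z-term
min(ord_v z, ord_v y) ≥ 1, otherwise the U-term ord_v z ≥ 1), so bracket ≥ N := #x⁻¹{0,1,∞}; Mason's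
fundamental ineq -/
@[route_item "route-ABC-GvfSupportTransfer"]
def FunctionFieldAKGenus : Prop :=
  ∀ (F : Type) [Field F] [Algebra ℂ F], Algebra.trdeg ℂ F = 1 → (⊤ : IntermediateField ℂ F).FG → ∀ g : ℕ, (∀ D : Literature.NumberTheory.DiophantineGeometry.AlgFunctionField.Divisor ℂ F, D.degree + 1 - (Literature.NumberTheory.DiophantineGeometry.AlgFunctionField.ell D : ℤ) ≤ g) → let h2 : F → ℤ := fun u => ∑ᶠ v : Literature.NumberTheory.DiophantineGeometry.AlgFunctionField.PlaceOver ℂ F, (v.degree : ℤ) * max 0 (-(v.ord u)); let h3 : F → F → ℤ := fun u w => ∑ᶠ v : Literature.NumberTheory.DiophantineGeometry.AlgFunctionField.PlaceOver ℂ F, (v.degree : ℤ) * max (max 0 (-(v.ord u))) (-(v.ord w)); let Z : F → F → ℤ := fun y z => h2 z⁻¹ + h2 y⁻¹ - h3 z⁻¹ y⁻¹; let U : ℕ → F → F → ℤ := fun K y z => h3 z⁻¹ (y⁻¹ ^ K) - h2 (y⁻¹ ^ K); ∀ K : ℕ, 1 ≤ K → ∀ x y : F, x ≠ 0 → x ≠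 1 → y ≠ 0 → h2 x - ((Z y x + U K y x) + (Z y (1 - x) + U K y (1 - x)) + (Z y x⁻¹ + U K y x⁻¹)) ≤ max 0 (2 * (g : ℤ) - 2)

/-- item stmt-ABC-11085 · support · rank 9 · open · by planner
sources: BYDHS2024GVFFoundations, Stothers1981
[support] GLUE OF THE DECIDING SPINE: LinearLawTransfer → FunctionFieldAKGenus → RationalTransferAK.
Fix K ≥ 1 and δ > 0. Take T = the A_K tuples, padded to a common length n+1 = 3 by repeating an
entry (height- and nonvanishing-preserving): (1,X), (Y,1), (XY,Y,X), (XY^K,Y^K,X), (1,1−X),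
((1−X)Y,Y,1−X), ((1−X)Y^K,Y^K,1−X), (Y,XY,1), (Y^K,XY^K,1), (Y^K,1), with integer coefficients c_j
chosen so that Σ_j c_j·h(T_j) = h(1:x) − Σ_{z∈{x,1−x,1/x}}[Z_y(z) + U_K(z,y)] =: φ_K on BOTH sides —
over ℚ exactly, by projective invariance (`Height.logHeight_smul_eq_logHeight`: h(1:z⁻¹:y⁻¹) =
h(zy:y:z), h(1:z⁻¹:y^{−K}) = h(zy^K:y^K:z), h(1:u⁻¹) = h(u:1), h(1:x:y⁻¹) = h(y:xy:1)); over F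
exactly, by the product formula Σ_v deg v·ord_v f = 0 (FunctionFieldDivisors
`degree_principalDivisor`, `ord_mul`, finite support) which turns Σ_v deg v·max(−ord(ξη), −ord η,
−ord ξ) into h3 ξ⁻¹ η⁻¹ = Σ_v deg v·max(0, ord ξ, ord η), etc. FunctionFieldAKGenus is precisely the
law φ_K ≤ 1·max(0, 2g−2) for all admissible (F, g) and all ξ ∉ {0,1}, η ≠ 0, which is 'off the
curves' for these tuples; LLT then gives H₀ with φ_K(x,y) ≤ δ·h(1:x:y) ≤ δ·(h(1:x) + h(1:y))
whenever h(1:x:y) ≥ H₀, and h(1:x:y) ≥ h(1:x) ≥ H₀ covers -/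
@[route_item "route-ABC-GvfSupportTransfer"]
def LawTransferGlue : Prop :=
  LinearLawTransfer → FunctionFieldAKGenus → RationalTransferAK

/-- item stmt-ABC-11086 · support · rank 9 · open · by planner
sources: BYDHS2024GVFFoundations
[support] DENSITY IS THE STRONGER FORM: GenusNegligibleDensity → LinearLawTransfer. Given a law (T,
c, C) valid on complex function fields and δ > 0, apply GND to T with ε := δ/(|C| + Σ_j|c_j| + 1);
for (x,y) off the curves with L = h(1:x:y) ≥ H₀ (w.l.o.g. H₀ ≥ 1, so L > 0) take (F, g, ξ, η, σ)
with σ > 0, σ(2g−2) ≤ εL, (ξ,η) off the curves and |h(T_j(x,y)) − σ·h_F(T_j(ξ,η))| ≤ εL; then Σ_j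
c_j h(T_j(x,y)) ≤ σ·Σ_j c_j h_F(T_j(ξ,η)) + (Σ|c_j|)εL ≤ σ·C·max(0, 2g−2) + (Σ|c_j|)εL ≤ max(0,C)·εL
+ (Σ|c_j|)εL ≤ δL, using σ·max(0,2g−2) = max(0, σ(2g−2)) ≤ εL. Pure bookkeeping over ℝ (no height
estimates). [deps: none] [difficulty: S] -/
@[route_item "route-ABC-GvfSupportTransfer"]
def DensityImpliesLawTransfer : Prop :=
  GenusNegligibleDensity → LinearLawTransfer

/-- item stmt-ABC-11087 · support · rank 9 · open · by planner
sources: BombieriGubler2006, Stichtenoth2009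
[support] TRANSFER HOLDS ON THE TORUS (provable calibration; new 2026-08-15): LinearLawTransfer
restricted to MONOMIAL tuples T_ji = X^{A_ji}·Y^{B_ji} (A, B : ℕ; the `let T := …` is literally that
instance) holds unconditionally. Proof sketch: for monomial tuples h(T_j(x,y)) = Σ_v w_v·F_j(u_v)
with F_j(u) = max_i(−(A_ji·u₁ + B_ji·u₂)) (a maximum of linear forms: continuous, positively
homogeneous), atoms u_p = (v_p(x), v_p(y)) of weight w_p = log p and u_∞ = (−log|x|, −log|y|) of
weight 1 (Mathlib `Height.logHeight` over ℚ = Σ over places of log max_i |·|_v via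
`NumberField.instAdmissibleAbsValues`; x, y ≠ 0 wherever a column has a positive exponent, by the
nonvanishing hypothesis), a BALANCED real configuration: Σ_v w_v u_v = 0 (product formula on ℚ). On
F/ℂ likewise h_F(T_j(ξ,η)) = Σ_v deg v·F_j(ord_v ξ, ord_v η) (ord_mul), balanced by
`degree_principalDivisor`. Every balanced INTEGER configuration (u_1,…,u_r, −Σu_k) is realised with
g = 0: F = ℂ(t) = `RatFunc ℂ` (trdeg 1, f.g.; g = 0 is an admissible bound since ℓ(D) ≥ deg D + 1 on
ℙ¹ — facts genus_ratFunc and degree_add_one_sub_ell_le_genus, both discharged), ξ = ∏_k (t −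
a_k)^{u_k,1}, η = ∏_k (t − a_k)^{u_k,2} with distinct a_ -/
@[route_item "route-ABC-GvfSupportTransfer"]
def ToricLawTransfer : Prop :=
  ∀ (m n : ℕ) (A B : Fin m → Fin (n + 1) → ℕ) (c : Fin m → ℝ) (C : ℝ), let T : Fin m → Fin (n + 1) → MvPolynomial (Fin 2) ℤ := fun j i => MvPolynomial.X 0 ^ A j i * MvPolynomial.X 1 ^ B j i; (∀ (F : Type) [Field F] [Algebra ℂ F], Algebra.trdeg ℂ F = 1 → (⊤ : IntermediateField ℂ F).FG → ∀ g : ℕ, (∀ D : Literature.NumberTheory.DiophantineGeometry.AlgFunctionField.Divisor ℂ F, D.degree + 1 - (Literature.NumberTheory.DiophantineGeometry.AlgFunctionField.ell D : ℤ) ≤ g) → ∀ ξ η : F, (∀ j i, MvPolynomial.aeval ![ξ, η] (T j i) ≠ 0) → ∑ j, c j * ∑ᶠ v : Literature.NumberTheory.DiophantineGeometry.AlgFunctionField.PlaceOver ℂ F, ((v.degree : ℝ) * ⨆ i, (-(v.ord (MvPolynomial.aeval ![ξ, η] (T j i))) : ℝ)) ≤ C * max 0 (2 * (g : ℝ) -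 2)) → ∀ δ : ℝ, 0 < δ → ∃ H₀ : ℝ, ∀ x y : ℚ, (∀ j i, MvPolynomial.aeval ![x, y] (T j i) ≠ 0) → H₀ ≤ Height.logHeight ![(1 : ℚ), x, y] → ∑ j, c j * Height.logHeight (fun i => MvPolynomial.aeval ![x, y] (T j i)) ≤ δ * Height.logHeight ![(1 : ℚ), x, y]

/-- item stmt-ABC-3218 · support · rank 9 · open · by planner
sources: Stothers1981
[support] GENUS-0 INSTANCE, PROVABLE NOW: for any field k of characteristic 0, K ≥ 1 and x, y ∈ k(t)
= `RatFunc k` with x ∉ {0,1}, y ≠ 0: h(1:x) ≤ Σ_z [Z_y(z) + U_K(z,y)], where the k(t)[1]-height of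
(1:u) is max(deg num u, deg den u) and that of (1:u:w) is max deg − deg gcd of the cleared triple
(den u·den w : num u·den w : num w·den u) (= Σ_π deg π·max_i(−ord_π ·) + max_i deg: finite places
are the monic irreducibles weighted by degree, plus ∞). Proof: x = A/C with A = num x, C = den x
coprime, B = C − A; at each finite place π | ABC the local Z + U ≥ deg π and ∞ contributes ≥ 0, so
bracket ≥ deg rad(ABC) ≥ max deg(A,B,C) + 1 > h(1:x) by Mathlib `Polynomial.abc` (Literature
`mason_stothers`), unless A, B, C are constants (then h(1:x) = 0 ≤ bracket). Calibrates the covering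
dictionary; g = 0 case of FunctionFieldAKGenus; first kernel check of the line. [difficulty:
provable-now] -/
@[route_item "route-ABC-GvfSupportTransfer"]
def FunctionFieldAK : Prop :=
  ∀ (k : Type) [Field k] [CharZero k] [DecidableEq k], let hp : Polynomial k → Polynomial k → Polynomial k → ℤ := fun p q r => ((max (max p.natDegree q.natDegree) r.natDegree : ℕ) : ℤ) - ((EuclideanDomain.gcd (EuclideanDomain.gcd p q) r).natDegree : ℤ); let h2 : RatFunc k → ℤ := fun u => ((max u.num.natDegree u.denom.natDegree : ℕ) : ℤ); let h3 : RatFunc k → RatFunc k → ℤ := fun u w => hp (u.denom * w.denom) (u.num * w.denom) (w.num * u.denom); let Z : RatFunc k → RatFunc k → ℤ := fun y z => h2 z⁻¹ + h2 y⁻¹ - h3 z⁻¹ y⁻¹; let U : ℕ → RatFunc k → RatFunc k → ℤ := fun K y z => h3 z⁻¹ (y⁻¹ ^ K) - h2 (y⁻¹ ^ K); ∀ K : ℕ, 1 ≤ K → ∀ x y : RatFunc k, x ≠ 0 → x ≠ 1 → y ≠ 0 → h2 x ≤ (Z y x + U K y x) + (Z y (1 - x) + U K y (1 - x)) + (Z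 y x⁻¹ + U K y x⁻¹)

/-- item stmt-ABC-3219 · support · rank 9 · open · by planner
sources: BYDHS2024GVFFoundations
[support] GLUE OF THE TWO-LAYER PLAN: GenusNegligibleDensity → FunctionFieldAKGenus →
RationalTransferAK. Fix K, δ and apply GND with ε = δ/40 to the 13 tuples (1,X), (1,Y), (XY,Y,X),
(XY^K,Y^K,X), ((1−X)Y,Y,1−X), ((1−X)Y^K,Y^K,1−X), (Y,XY,1), (Y^K,XY^K,1), (X,1), (1−X,1), (Y,1),
(Y^K,1): all entries are non-zero for x ∉ {0,1}, y ≠ 0, and h((XY:Y:X)(x,y)) = h(1:x⁻¹:y⁻¹) etc. by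
projective invariance (`Height.logHeight_smul_eq_logHeight` on ℚ; on F the product formula Σ_v deg
v·ord_v f = 0, Literature `degree_principalDivisor`), so the 13 values determine φ_K on both sides.
For (x,y) with L = h(1:x:y) ≥ H₀ take (F, ξ, η, σ) from GND; FunctionFieldAKGenus gives σ·φ_K(ξ,η) ≤
σ·max(0, 2g−2) ≤ εL; the approximations give |φ_K(x,y) − σ·φ_K(ξ,η)| ≤ 26εL; and L ≤ h(1:x) +
h(1:y); pairs of small height are absorbed into H₀. [difficulty: M] -/
@[route_item "route-ABC-GvfSupportTransfer"]
def TransferGlue : Prop :=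
  GenusNegligibleDensity → FunctionFieldAKGenus → RationalTransferAK

/-- item stmt-ABC-3220 · support · rank 9 · open · by planner
sources: BombieriGubler2006
[support] THE BRIDGE LOSES NOTHING: ABC → RationalTransferAK. For x = a/c in lowest terms (a ≠ 0, c
> 0, a ≠ c) and b = c − a, every prime p | abc contributes ≥ log p to the bracket (Z-term ≥ log p if
v_p(y) ≥ 1, else U-term ≥ v_p·log p) and all local terms are ≥ 0, so bracket ≥ log rad(|a|·|b|·c);
the positive rearrangement of (a, b, c) is an abc triple (`IsABCTriple`) with the same radical and
maximum M ≥ max(|a|, c) = exp h(1:x); ABC at ε' with ε'/(1+ε') < δ gives h(1:x) − bracket ≤ h(1:x) −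
(log M − log C_ε')/(1+ε') ≤ δ·h(1:x) once h(1:x) ≥ H₀. Shows X ⟺ ABC: the route is an honest
transfer formulation of abc, neither weaker nor stronger at the target. [difficulty: M] -/
@[route_item "route-ABC-GvfSupportTransfer"]
def ABCImpliesTransfer : Prop :=
  ABC → RationalTransferAK

/-- item stmt-ABC-3221 · support · rank 9 · open · by planner
sources: BenYaacovHrushovski2022GVF
[support] RATIONALITY IS ESSENTIAL: the sentence A_4 fails on algebraic points of degree ≤ 4 by a
fixed proportion of the height — ∃δ > 0 ∀H₀ ∃ number field L with [L:ℚ] ≤ 4 and x, y ∈ L, h(1:x) ≥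
H₀, with φ_4(x,y) ≥ δ·(h(1:x) + h(1:y)) (Mathlib relative heights on L; the ratio is
normalisation-free). Witness: x = N (even, large), y⁴ = N(1−N)/(1+N³), L = ℚ(y): at every place v(y)
= v(x(1−x)/(1+x³))/4, so each zero of x, 1−x, 1/x is covered at exactly 1/4 of its mass and U_4 ≡ 0;
bracket = (3/4)·h(1:x) + O(1), φ_4 = h(1:x)/4 − O(1), h(1:y) ≤ (3/4)·h(1:x) + O(1); δ = 1/8 works.
General K: y = (x(1−x)/(1+x³))^(1/K) gives φ_K = (1 − 3/K)·h(1:x) on points of degree K (the curve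
y^K = x(1−x)/(1+x³) has genus 2K − 2 over degree K: NOT genus-negligible — consistent with
FunctionFieldAKGenus). Hence the asymptotic universal GVF theory of ℚ̄ omits every A_K, K ≥ 4 (it is
exactly the GVF axioms, BenYaacovHrushovski2022GVF Rem 2.2), and any transfer principle must see
rationality / bounded degree with a discriminant term
(Literature.Barriers.ABC.UniformABCDiscriminantSharp). [difficulty: M] -/
@[route_item "route-ABC-GvfSupportTransfer"]
def FailsForQuarticPoints : Prop :=
  ∃ δ : ℝ, 0 < δ ∧ ∀ H₀ : ℝ, ∃ (L : Type) (_ : Field L) (_ : NumberField L) (x y : L), Module.finrank ℚ L ≤ 4 ∧ x ≠ 0 ∧ x ≠ 1 ∧ y ≠ 0 ∧ H₀ ≤ Height.logHeight ![(1 : L), x] ∧ δ * (Height.logHeight ![(1 : L), x] + Height.logHeight ![(1 : L), y]) ≤ Height.logHeight ![(1 : L), x] - (((Height.logHeight ![(1 : L), x⁻¹] + Height.logHeight ![(1 : L), y⁻¹] - Height.logHeight ![(1 : L), x⁻¹, y⁻¹]) + (Height.logHeight ![(1 : L), x⁻¹, y⁻¹ ^ 4] - Height.logHeight ![(1 : L),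 y⁻¹ ^ 4])) + ((Height.logHeight ![(1 : L), (1 - x)⁻¹] + Height.logHeight ![(1 : L), y⁻¹] - Height.logHeight ![(1 : L), (1 - x)⁻¹, y⁻¹]) + (Height.logHeight ![(1 : L), (1 - x)⁻¹, y⁻¹ ^ 4] - Height.logHeight ![(1 : L), y⁻¹ ^ 4])) + ((Height.logHeight ![(1 : L), x] + Height.logHeight ![(1 : L), y⁻¹] - Height.logHeight ![(1 : L), x, y⁻¹]) + (Height.logHeight ![(1 : L), x, y⁻¹ ^ 4] - Height.logHeight ![(1 : L), y⁻¹ ^ 4])))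

/-- item stmt-ABC-3215 · assembly · rank 1 · open · by planner
sources: BombieriGubler2006
[assembly] RationalTransferAK → ABC. Given ε ∈ (0,1) take K = ⌈40/ε⌉, δ = ε/40 and H₀ from X. For an
abc triple (a,b,c) with log c ≥ H₀ put x = a/c (1−x = b/c, h(1:x) = log c by
`Rat.logHeight_eq_max_abs_of_gcd_eq_one`), m = min(a,b), Y = ∏_{p|abc} p^⌈v_p(abc)/K⌉, q = least
prime not dividing abc (if all primes ≤ T divide abc then ∏_{i<log₂T} (a prime in (2^i, 2^(i+1)],
`Nat.exists_prime_lt_and_le_two_mul`) ≤ abc < c³, so log q ≤ 2√(3 log c) + 1), j = ⌈(log Y +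
(log(c/m))/K)/log q⌉, y = Y/q^j. Local evaluation (clear denominators;
`Rat.logHeight_eq_max_abs_of_gcd_eq_one`, `Height.logHeight_smul_eq_logHeight`, log gcd = Σ_p min
v_p · log p): at p | abc with v = v_p(abc), n = ⌈v/K⌉ the Z-term is n·log p and the U-term (v −
Kn)⁺·log p = 0; at q everything is 0; at ∞, v_∞(y) = j log q − log Y ∈ [log(c/m)/K, log(c/m)/K + log
q), so the U-terms of z = x, z = 1−x vanish (v_∞(x)⁺ = log(c/a), v_∞(1−x)⁺ = log(c/b) ≤ K·v_∞(y))
and their Z-terms are ≤ v_∞(y) each; z = 1/x has no archimedean zero. Hence bracket ≤ log Y + 2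
log(c/m)/K + 2 log q ≤ log rad(abc) + (1/K) log(abc) + (2/K) log c + 2 log q and h(1:y) ≤ log Y + j
log q ≤ 5 log c; X gives log c − bracket ≤ 6δ log c, so (1 − 5/K − 6δ) log -/
@[route_item "route-ABC-GvfSupportTransfer"]
def Assembly : Prop :=
  RationalTransferAK → ABC

/-! D-0027 §2.1 — DECIDING THEOREM (planner-authored via `route open/edit --closes-file`; by planner-rbadge-ABC-GvfSupportTransfer-1388b889-g2-0 2026-08-15T16:45:38Z):
its hypotheses are this route's items and its conclusion the sub-problem Statement (glue_lint), and it elaborates with this file. -/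

@[closes "route-ABC-GvfSupportTransfer"] theorem closes : LinearLawTransfer → FunctionFieldAKGenus → LawTransferGlue → Assembly → _root_.ABC := fun hL hM hG hA => hA (hG hL hM)

end Summit.ABC.ABC.Theses.GvfSupportTransfer
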